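import Summits.QuantumFields.YangMills.Theses.DirichletWindow
import Summits.QuantumFields.YangMills.Theorems.EquipartitionCriticalityCriticalContinuumLimitStubLatticeGap
import Summits.QuantumFields.YangMills.Theorems.EquipartitionCriticalityCriticalContinuumLimitStubOneFieldExtension
import Literature.MathematicalPhysics.QuantumFieldTheory.GaugeOSData

/-!
# Birth skeleton (BC3) for crux `WeakCouplingContinuumLimit` (stmt-QuantumFields-15940) — `Lines/birth.lean`

Registrar: `planner-skel-stmt-QuantumFields-15940-0` (skeleton-register one-shot; route
`route-QuantumFields-DirichletWindow`, re-audit bin REPAIRABLE; the crux is SHARED with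
`route-QuantumFields-EquipartitionCriticality`, whose decl `CriticalContinuumLimit` has the byte-identical
ledger signature), 2026-08-17.

Crux (route file `Theses/DirichletWindow.lean`, decl
`Summit.QuantumFields.YangMills.Theses.DirichletWindow.WeakCouplingContinuumLimit`): for every compact simple `G`
(Borel structure from the topology), IF (H1) every faithful `r` has a volume-uniform all-pairs lattice
gap at all large `β` (`LatticeGapLargeBeta` shape) AND (H2) every admissible volume-uniform rate function
tends to `0` (criticality at `β = ∞`), THEN `∃ r sch T`, `sch.HasWeakCouplingLimit ∧ IsYangMillsFor r sch T ∧
T.IsNontrivial r.curvature ∧ T.IsNonGaussian r.curvature ∧ ∃ Δ > 0, T.HasMassGap Δ ∧ HasLatticeMassGap r sch Δ`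
— the re-typed (p116790) `∃`-body of `YangMills`.  It is the re-type of crux stmt-QuantumFields-8762
(`CriticalContinuumLimit`, closed moot): same hypotheses, conclusion + `sch.HasWeakCouplingLimit`.

## The cut (three stubs, tree vocabulary only; composition = landed glue)

What (H1) + (H2) BUY is lattice-side and is isolated in stub 1; what remains is the continuum leg, cut
into its existence half (stub 2) and its interaction half (stub 3):

* `stub_saturatedCriticalRate` — **lattice infrared (requantisation + saturation).**  From `hG`, a
  faithful `r`, the H1 data `(β₁, m, S₀)` and H2 for `r`: a uniformly admissible rate `(βs, ms, Ss)`
  (same H1 shape, so H2 makes it critical in the glue) which the curvature SATURATES — cofinally in `β`,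
  in every window `n · ms β ≤ κ` and on arbitrarily large odd tori, the `Θ`-paired plaquette correlator
  `latticeConnectedCorr r.ρ β (2S+1) (P ∘ gaugeTimeReflect) P n` is `≥ w e^{-C₀ ms(β) n}` (the shape (P)
  consumed by the predecessor lead's registered `stub_continuumCore`, v4).  I.e. `ms` is comparable to the
  TRUE lattice mass and the scalar glueball couples to the plaquette at that scale.  Why it might fail:
  near-optimality needs the infinite-volume transfer gap of every odd-torus limit state to be re-exported
  as volume-uniform torus clustering with `β`-UNIFORM constants (lead's open I1 `stub_gapRequantisation`;
  I0 `stub_admissibleGivesGap` is landed), and saturation needs `m_{0++}(β) ≤ C₀ · m⋆(β)` cofinally in `β`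
  (lead's open I2 `stub_transverseShell`, "open physics"; its v2 form without `hG`/H2 was REFUTED at
  `G := Unit`, hence both hypotheses are carried here).  Size L–XL.
* `stub_continuumLimitOS` — **continuum existence at the critical point (UV/OS leg).**  Verbatim the
  predecessor's registered `stub_continuumCore` (v4 signature, `ledger workitem get stmt-QuantumFields-8762`
  → `stubs[]`) with the `IsNonGaussian` conjunct REMOVED: from a critical, saturated, uniformly admissible
  rate there are `Δ > 0`, a scheme RIDING the rate (`β_k → ∞`, `β_k ≥ βs` and `Ss(β_k) ≤ L_k` eventually,
  `a_k = ms(β_k)/Δ`) and ONE Schwinger family `S₁` on `ℝ⁴` (the renormalised curvature) with the OS axioms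
  E0', E0–E4 (full `SO(4)`: E1 is inside), convergence of the curvature `n`-point functions along the
  scheme, a non-trivial truncated two-point function, and `HasMassGap Δ`.  Why it might fail: tightness /
  temperedness of the renormalised `tr F²` at scale `a_k` (uniform E0'), `SO(4)` restoration of
  subsequential limits, and the gap in OS currency (the D3b defect of crux `GapToContinuum`) are each open;
  (P) is what pins the field normalisation so that the limit is neither `0` nor ultralocal.  Size: open problem.
* `stub_nonGaussianLimit` — **interaction (the `ScalarPhi4Triviality`-facing piece, named on its own).**
  For compact simple `G`: every such limit — one OS field `S₁` to which the renormalised curvature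
  functions converge along a weak-coupling scheme riding a uniformly admissible rate at gap `Δ > 0`, with
  non-trivial two-point function and mass gap `Δ` — has a non-vanishing connected three-point function on
  `⁰𝒮`.  Why it might fail: it is the Yang–Mills analogue of the statement that FAILS for `φ⁴₄`
  (Aizenman–Duminil-Copin 2021, `Literature.Barriers.QuantumFields.ScalarPhi4Triviality`); the hypotheses
  self-select the physical scaling (`a_k ≫ m⋆(β_k)` makes the limit massless, `a_k ≪ m⋆(β_k)` makes it
  ultralocal, both excluded), so no junk scheme is known to bite, but nothing is proved for any 4-d
  non-abelian `G`.  Size: open problem.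
* `WeakCouplingContinuumLimit_of` — the composition, a REAL proof: `r` from `hG.2`; H1 opened; stub 1;
  criticality of `ms` from H2 (three lines); stub 2; stub 3; then the LANDED theorems of the predecessor
  line — `Theorems.CriticalContinuumLimit.stub_oneFieldExtension` (p104332: extension by zero + silencing
  scheme `onlySpecies sch r.curvature` gives `OSData` over ALL species with `IsYangMillsFor`, the three
  curvature clauses and `HasMassGap Δ`) and `Theorems.CriticalContinuumLimit.stub_latticeGap` (p103064:
  `HasLatticeMassGap` re-indexed along the riding scheme, `C e^{-ms(β_k) n} = C e^{-Δ a_k n}`) — and the new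
  conjunct `HasWeakCouplingLimit` is `Tendsto sch.β atTop atTop` carried through `onlySpecies` (which
  only touches `c`).  The `example` after it is the same glue with the three stub STATEMENTS as explicit
  hypotheses and no reference to the stubs (so any `sorry` there would be flagged — there is none).

## Relation to the predecessor line and honest status

This is the PICKED line `Sketch` (idea `euclidean-crossing-saturation`) of crux 8762 ported to the
re-typed crux at birth granularity: its landed pieces are consumed as theorems, its open remainder is
named in three stubs.  The lead's finer lattice decomposition (I1 `stub_gapRequantisation`, I2
`stub_transverseShell`, the proved-in-skeleton `longitudinal_alternative` / `saturation_of_frames` /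
`transverse_of_inputs` over the landed torus stubs `stub_thetaCorrBound`, `stub_thetaCorrRP`,
`stub_bentCumulantCS` and kernels `longitudinal_of_torusData`, `twoFrameSqueeze`) is a decomposition
of `stub_saturatedCriticalRate` one layer down and is NOT re-filed here (the v7 work file is not on this
hub; its registered signatures are).  All three stubs are OPEN; stub 2 + stub 3 together are "most of
Clay given the infrared input" exactly as the crux's why-line says — this file certifies SHAPE (a
non-trivial three-way cut, no stub the crux or the summit: probes in the registrar's `bc/` folder), not
tractability.  No `Disproof.lean` exists for 15940 or 8762 (`ledger crux ls`), so no `_false_without_`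
constraint is known; the v2 refutation `stub_requantisation_false` (G := Unit, every rate admissible) is
honoured by carrying `hG` and H2 in stub 1.  Foreseen split of stub 2 (not filed): OS existence + E1 +
non-triviality ∣ gap in OS currency via the tree's `OSData.hasMassGap_of_clustersDiag` (R5) and the
landed I0 `stub_admissibleGivesGap` (`HasInfiniteVolumeGap` from admissibility).

`lean check`: rc 0; sorries = 3 = stubs (`stub_saturatedCriticalRate`, `stub_continuumLimitOS`,
`stub_nonGaussianLimit`), zero elsewhere.  Namespace `Summit.QuantumFields.YangMills.Cruxes.WeakCouplingContinuumLimit.Birth`.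
-/

noncomputable section

open scoped SchwartzMap
open MeasureTheory Filter Topology
open Literature.MathematicalPhysics.AQFT Literature.MathematicalPhysics.QuantumLattice
open Literature.MathematicalPhysics.QuantumFieldTheory
open Summit.QuantumFields.YangMills.Theorems.HypercubicLimit.Negative (onlySpecies)

namespace Summit.QuantumFields.YangMills.Cruxes.WeakCouplingContinuumLimit.Birth

/-- The crux this skeleton closes (by name). -/
example : Prop := Summit.QuantumFields.YangMills.Theses.DirichletWindow.WeakCouplingContinuumLimit

variable {G : Type} [Group G] [TopologicalSpace G] [IsTopologicalGroup G] [CompactSpace G]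
  [MeasurableSpace G] [BorelSpace G]

/-! ## Stubs -/

/-- **stub_saturatedCriticalRate** (lattice infrared: requantisation to the true mass + saturation by
the plaquette; OPEN).  From a compact simple `G`, a faithful `r`, one uniformly admissible rate
`(β₁, m, S₀)` (H1 opened) and criticality of every admissible rate (H2 for `r`): a uniformly admissible
rate `(βs, ms, Ss)` which the `Θ`-paired curvature two-point function saturates up to the factor `C₀`,
cofinally in `β`, in every window `n · ms β ≤ κ`, frequently in the odd torus half-side `S`. -/
theorem stub_saturatedCriticalRate (hG : IsCompactSimpleLieGroup G) (r : LatticeRep G)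
    (β₁ : ℝ) (m : ℝ → ℝ) (S₀ : ℝ → ℕ) (hpos : ∀ β : ℝ, β₁ ≤ β → 0 < m β)
    (hdec : ∀ A B : YMSpecies G, ∃ C : ℝ, ∀ β : ℝ, β₁ ≤ β → ∀ S n : ℕ, S₀ β ≤ S → n ≤ S →
        |latticeConnectedCorr r.ρ β (2 * S + 1) A.F B.F n| ≤ C * Real.exp (-(m β * n)))
    (H2 : ∀ (β₂ : ℝ) (m₂ : ℝ → ℝ), (∀ β : ℝ, β₂ ≤ β → 0 < m₂ β ∧ (∃ S₂ : ℕ, ∀ A B : YMSpecies G,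
        ∃ C : ℝ, ∀ S n : ℕ, S₂ ≤ S → n ≤ S →
          |latticeConnectedCorr r.ρ β (2 * S + 1) A.F B.F n| ≤ C * Real.exp (-(m₂ β * n)))) →
        ∀ m₀ : ℝ, 0 < m₀ → ∀ᶠ β : ℝ in atTop, m₂ β < m₀) :
    ∃ (βs : ℝ) (ms : ℝ → ℝ) (Ss : ℝ → ℕ),
      (∀ β : ℝ, βs ≤ β → 0 < ms β) ∧
      (∀ A B : YMSpecies G, ∃ C : ℝ, ∀ β : ℝ, βs ≤ β → ∀ S n : ℕ, Ss β ≤ S → n ≤ S →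
        |latticeConnectedCorr r.ρ β (2 * S + 1) A.F B.F n| ≤ C * Real.exp (-(ms β * n))) ∧
      ∃ C₀ : ℝ, 0 < C₀ ∧ ∃ᶠ β : ℝ in atTop, ∀ κ : ℝ, 0 < κ → ∃ w : ℝ, 0 < w ∧
        ∃ᶠ S : ℕ in atTop, ∀ n : ℕ, (n : ℝ) * ms β ≤ κ →
          w * Real.exp (-(C₀ * (ms β * n))) ≤
            latticeConnectedCorr r.ρ β (2 * S + 1) (r.curvature.F ∘ gaugeTimeReflect) r.curvature.F n := by
  sorry

/-- **stub_continuumLimitOS** (continuum existence at the critical point — the UV/OS leg; OPEN; =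
registered `stub_continuumCore` of stmt-QuantumFields-8762, v4, without its `IsNonGaussian` conjunct).
From a critical, saturated, uniformly admissible rate: `Δ > 0`, a scheme riding the rate at gap `Δ`
with `β_k → ∞`, and ONE OS Schwinger family `S₁` (E0', E0–E4) for the renormalised curvature, limit of
the lattice curvature `n`-point functions along the scheme, with non-trivial truncated two-point function
and `HasMassGap Δ`. -/
theorem stub_continuumLimitOS (r : LatticeRep G) (βs : ℝ) (ms : ℝ → ℝ) (Ss : ℝ → ℕ)
    (hpos : ∀ β : ℝ, βs ≤ β → 0 < ms β)
    (hdec : ∀ A B : YMSpecies G, ∃ C : ℝ, ∀ β : ℝ, βs ≤ β → ∀ S n : ℕ, Ss β ≤ S → n ≤ S →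
        |latticeConnectedCorr r.ρ β (2 * S + 1) A.F B.F n| ≤ C * Real.exp (-(ms β * n)))
    (hcrit : ∀ m₀ : ℝ, 0 < m₀ → ∀ᶠ β : ℝ in atTop, ms β < m₀)
    (hP : ∃ C₀ : ℝ, 0 < C₀ ∧ ∃ᶠ β : ℝ in atTop, ∀ κ : ℝ, 0 < κ → ∃ w : ℝ, 0 < w ∧
        ∃ᶠ S : ℕ in atTop, ∀ n : ℕ, (n : ℝ) * ms β ≤ κ →
          w * Real.exp (-(C₀ * (ms β * n))) ≤
            latticeConnectedCorr r.ρ β (2 * S + 1) (r.curvature.F ∘ gaugeTimeReflect) r.curvature.F n) :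
    ∃ (Δ : ℝ) (sch : SpeciesScheme (YMSpecies G)) (S₁ : SchwingerFamily (EuclideanSpace ℝ (Fin 4))),
      0 < Δ ∧ Tendsto sch.β atTop atTop ∧ (∀ᶠ k in atTop, βs ≤ sch.β k) ∧
      (∀ k, sch.a k = ms (sch.β k) / Δ) ∧ (∀ᶠ k in atTop, Ss (sch.β k) ≤ sch.L k) ∧
      OSAxiomsSchwinger S₁.toLabelled ∧
      (∀ (n : ℕ), n ≠ 0 → ∀ (f : Fin n → 𝓢(EuclideanSpace ℝ (Fin 4), ℝ))
        (F : 𝓢((Fin n → EuclideanSpace ℝ (Fin 4)), ℂ)),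
        IsTensorOf F (fun i => ofRealTest (f i)) → IsOffDiagonal F →
          Tendsto (fun k : ℕ =>
            ((latticeSchwinger r.ρ sch (fun s => s.F) k n (fun _ => r.curvature) f : ℝ) : ℂ))
            atTop (𝓝 (S₁ n F))) ∧
      (∃ (F₁ G₁ : 𝓢((Fin 1 → EuclideanSpace ℝ (Fin 4)), ℂ))
        (H₁ : 𝓢((Fin (1 + 1) → EuclideanSpace ℝ (Fin 4)), ℂ)),
        IsTimeOrdered F₁ ∧ IsTimeOrdered G₁ ∧ IsAppendTensorOf H₁ (osAdjoint F₁) G₁ ∧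
          S₁ (1 + 1) H₁ ≠ S₁ 1 (osAdjoint F₁) * S₁ 1 G₁) ∧
      S₁.toLabelled.HasMassGap Δ := by
  sorry

/-- **stub_nonGaussianLimit** (interaction; OPEN; the `ScalarPhi4Triviality`-facing piece).  For compact
simple `G`: a one-field OS limit `S₁` of the renormalised curvature along a weak-coupling scheme riding a
uniformly admissible rate at gap `Δ > 0`, with non-trivial two-point function and mass gap `Δ`, has a
non-vanishing connected three-point function on `⁰𝒮` (is not a generalised free field). -/
theorem stub_nonGaussianLimit (hG : IsCompactSimpleLieGroup G) (r : LatticeRep G)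
    (βs : ℝ) (ms : ℝ → ℝ) (Ss : ℝ → ℕ) (hpos : ∀ β : ℝ, βs ≤ β → 0 < ms β)
    (hdec : ∀ A B : YMSpecies G, ∃ C : ℝ, ∀ β : ℝ, βs ≤ β → ∀ S n : ℕ, Ss β ≤ S → n ≤ S →
        |latticeConnectedCorr r.ρ β (2 * S + 1) A.F B.F n| ≤ C * Real.exp (-(ms β * n)))
    (Δ : ℝ) (hΔ : 0 < Δ) (sch : SpeciesScheme (YMSpecies G))
    (hride : Tendsto sch.β atTop atTop ∧ (∀ᶠ k in atTop, βs ≤ sch.β k) ∧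
      (∀ k, sch.a k = ms (sch.β k) / Δ) ∧ (∀ᶠ k in atTop, Ss (sch.β k) ≤ sch.L k))
    (S₁ : SchwingerFamily (EuclideanSpace ℝ (Fin 4))) (hOS : OSAxiomsSchwinger S₁.toLabelled)
    (hconv : ∀ (n : ℕ), n ≠ 0 → ∀ (f : Fin n → 𝓢(EuclideanSpace ℝ (Fin 4), ℝ))
        (F : 𝓢((Fin n → EuclideanSpace ℝ (Fin 4)), ℂ)),
        IsTensorOf F (fun i => ofRealTest (f i)) → IsOffDiagonal F →
          Tendsto (fun k : ℕ =>
            ((latticeSchwinger r.ρ sch (fun s => s.F) k n (fun _ => r.curvature) f : ℝ) : ℂ))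
            atTop (𝓝 (S₁ n F)))
    (hnt : ∃ (F₁ G₁ : 𝓢((Fin 1 → EuclideanSpace ℝ (Fin 4)), ℂ))
        (H₁ : 𝓢((Fin (1 + 1) → EuclideanSpace ℝ (Fin 4)), ℂ)),
        IsTimeOrdered F₁ ∧ IsTimeOrdered G₁ ∧ IsAppendTensorOf H₁ (osAdjoint F₁) G₁ ∧
          S₁ (1 + 1) H₁ ≠ S₁ 1 (osAdjoint F₁) * S₁ 1 G₁)
    (hgap : S₁.toLabelled.HasMassGap Δ) :
    ∃ (f g h : 𝓢(EuclideanSpace ℝ (Fin 4), ℂ)) (Ffgh : 𝓢((Fin 3 → EuclideanSpace ℝ (Fin 4)), ℂ))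
        (Fgh Ffh Ffg : 𝓢((Fin 2 → EuclideanSpace ℝ (Fin 4)), ℂ))
        (Ff Fg Fh : 𝓢((Fin 1 → EuclideanSpace ℝ (Fin 4)), ℂ)),
        IsTensorOf Ffgh ![f, g, h] ∧ IsOffDiagonal Ffgh ∧ IsTensorOf Fgh ![g, h] ∧
        IsTensorOf Ffh ![f, h] ∧ IsTensorOf Ffg ![f, g] ∧ IsTensorOf Ff ![f] ∧ IsTensorOf Fg ![g] ∧
        IsTensorOf Fh ![h] ∧
          S₁ 3 Ffgh - S₁ 1 Ff * S₁ 2 Fgh - S₁ 1 Fg * S₁ 2 Ffh - S₁ 1 Fh * S₁ 2 Ffg +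
            2 * (S₁ 1 Ff * S₁ 1 Fg * S₁ 1 Fh) ≠ 0 := by
  sorry

/-! ## Composition -/

/-- **The line closes the crux modulo its three stubs** (registered form: the stubs BY NAME inside the
proof; everything else is landed tree theorems and three lines of logic). -/
theorem WeakCouplingContinuumLimit_of :
    Summit.QuantumFields.YangMills.Theses.DirichletWindow.WeakCouplingContinuumLimit := by
  intro G _ _ _ _ hG H1 H2
  letI : MeasurableSpace G := borel G
  haveI : BorelSpace G := ⟨rfl⟩
  -- a faithful representation (`IsCompactSimpleLieGroup` = simple ∧ linear)
  obtain ⟨r⟩ := hG.2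
  -- H1 for `r`: one uniformly admissible rate
  obtain ⟨β₁, m, S₀, hpos, hdec⟩ := H1 r
  -- STUB 1 (lattice infrared): a uniformly admissible rate saturated by the plaquette
  obtain ⟨βs, ms, Ss, hpos', hdec', hP⟩ := stub_saturatedCriticalRate hG r β₁ m S₀ hpos hdec (H2 r)
  -- H2: the saturated rate is admissible, hence critical
  have hcrit : ∀ m₀ : ℝ, 0 < m₀ → ∀ᶠ β : ℝ in atTop, ms β < m₀ := by
    refine H2 r βs ms fun β hβ => ⟨hpos' β hβ, Ss β, fun A B => ?_⟩
    obtain ⟨C, hC⟩ := hdec' A B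
    exact ⟨C, fun S n hS hn => hC β hβ S n hS hn⟩
  -- STUB 2 (continuum ultraviolet / OS leg): scheme riding `ms` at gap `Δ`, one OS field, alive, massive
  obtain ⟨Δ, sch, S₁, hΔ, hβtop, hβk, hak, hLk, hOS, hconv, hnt, hgap⟩ :=
    stub_continuumLimitOS r βs ms Ss hpos' hdec' hcrit hP
  -- STUB 3 (interaction): that limit is not a generalised free field
  have hng := stub_nonGaussianLimit hG r βs ms Ss hpos' hdec' Δ hΔ sch ⟨hβtop, hβk, hak, hLk⟩ S₁ hOS hconv hnt hgap
  -- LANDED glue (line `Sketch` of the predecessor crux 8762): all-species packaging by silencing,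
  -- and the lattice clause re-indexed along the riding scheme
  obtain ⟨T, hYM, hT1, hT2, hT3⟩ :=
    Theorems.CriticalContinuumLimit.stub_oneFieldExtension r sch S₁ Δ hOS hconv hnt hng hgap
  have hlat : HasLatticeMassGap r (onlySpecies sch r.curvature) Δ :=
    Theorems.CriticalContinuumLimit.stub_latticeGap r βs ms Ss Δ hΔ hdec'
      (onlySpecies sch r.curvature) hβk hak hLk
  -- the new conjunct of the re-typed statement: `β_k → ∞` (silencing keeps `β`)
  have hw : (onlySpecies sch r.curvature).HasWeakCouplingLimit := hβtop
  exact ⟨r, onlySpecies sch r.curvature, T, hw, hYM, hT1, hT2, Δ, hΔ, hT3, hlat⟩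

/-- **The glue alone, `sorry`-free**: the three stub STATEMENTS (verbatim, as closed propositions) imply
the crux; this `example` does not mention the stubs. -/
example
    (h₁ : ∀ {G : Type} [Group G] [TopologicalSpace G] [IsTopologicalGroup G] [CompactSpace G]
    [MeasurableSpace G] [BorelSpace G]
    (hG : IsCompactSimpleLieGroup G) (r : LatticeRep G)
    (β₁ : ℝ) (m : ℝ → ℝ) (S₀ : ℝ → ℕ) (hpos : ∀ β : ℝ, β₁ ≤ β → 0 < m β)
    (hdec : ∀ A B : YMSpecies G, ∃ C : ℝ, ∀ β : ℝ, β₁ ≤ β → ∀ S n : ℕ, S₀ β ≤ S → n ≤ S →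
        |latticeConnectedCorr r.ρ β (2 * S + 1) A.F B.F n| ≤ C * Real.exp (-(m β * n)))
    (H2 : ∀ (β₂ : ℝ) (m₂ : ℝ → ℝ), (∀ β : ℝ, β₂ ≤ β → 0 < m₂ β ∧ (∃ S₂ : ℕ, ∀ A B : YMSpecies G,
        ∃ C : ℝ, ∀ S n : ℕ, S₂ ≤ S → n ≤ S →
          |latticeConnectedCorr r.ρ β (2 * S + 1) A.F B.F n| ≤ C * Real.exp (-(m₂ β * n)))) →
        ∀ m₀ : ℝ, 0 < m₀ → ∀ᶠ β : ℝ in atTop, m₂ β < m₀),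
    ∃ (βs : ℝ) (ms : ℝ → ℝ) (Ss : ℝ → ℕ),
      (∀ β : ℝ, βs ≤ β → 0 < ms β) ∧
      (∀ A B : YMSpecies G, ∃ C : ℝ, ∀ β : ℝ, βs ≤ β → ∀ S n : ℕ, Ss β ≤ S → n ≤ S →
        |latticeConnectedCorr r.ρ β (2 * S + 1) A.F B.F n| ≤ C * Real.exp (-(ms β * n))) ∧
      ∃ C₀ : ℝ, 0 < C₀ ∧ ∃ᶠ β : ℝ in atTop, ∀ κ : ℝ, 0 < κ → ∃ w : ℝ, 0 < w ∧
        ∃ᶠ S : ℕ in atTop, ∀ n : ℕ, (n : ℝ) * ms β ≤ κ →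
          w * Real.exp (-(C₀ * (ms β * n))) ≤
            latticeConnectedCorr r.ρ β (2 * S + 1) (r.curvature.F ∘ gaugeTimeReflect) r.curvature.F n)
    (h₂ : ∀ {G : Type} [Group G] [TopologicalSpace G] [IsTopologicalGroup G] [CompactSpace G]
    [MeasurableSpace G] [BorelSpace G]
    (r : LatticeRep G) (βs : ℝ) (ms : ℝ → ℝ) (Ss : ℝ → ℕ)
    (hpos : ∀ β : ℝ, βs ≤ β → 0 < ms β)
    (hdec : ∀ A B : YMSpecies G, ∃ C : ℝ, ∀ β : ℝ, βs ≤ β → ∀ S n : ℕ, Ss β ≤ S → n ≤ S →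
        |latticeConnectedCorr r.ρ β (2 * S + 1) A.F B.F n| ≤ C * Real.exp (-(ms β * n)))
    (hcrit : ∀ m₀ : ℝ, 0 < m₀ → ∀ᶠ β : ℝ in atTop, ms β < m₀)
    (hP : ∃ C₀ : ℝ, 0 < C₀ ∧ ∃ᶠ β : ℝ in atTop, ∀ κ : ℝ, 0 < κ → ∃ w : ℝ, 0 < w ∧
        ∃ᶠ S : ℕ in atTop, ∀ n : ℕ, (n : ℝ) * ms β ≤ κ →
          w * Real.exp (-(C₀ * (ms β * n))) ≤
            latticeConnectedCorr r.ρ β (2 * S + 1) (r.curvature.F ∘ gaugeTimeReflect) r.curvature.F n),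
    ∃ (Δ : ℝ) (sch : SpeciesScheme (YMSpecies G)) (S₁ : SchwingerFamily (EuclideanSpace ℝ (Fin 4))),
      0 < Δ ∧ Tendsto sch.β atTop atTop ∧ (∀ᶠ k in atTop, βs ≤ sch.β k) ∧
      (∀ k, sch.a k = ms (sch.β k) / Δ) ∧ (∀ᶠ k in atTop, Ss (sch.β k) ≤ sch.L k) ∧
      OSAxiomsSchwinger S₁.toLabelled ∧
      (∀ (n : ℕ), n ≠ 0 → ∀ (f : Fin n → 𝓢(EuclideanSpace ℝ (Fin 4), ℝ))
        (F : 𝓢((Fin n → EuclideanSpace ℝ (Fin 4)), ℂ)),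
        IsTensorOf F (fun i => ofRealTest (f i)) → IsOffDiagonal F →
          Tendsto (fun k : ℕ =>
            ((latticeSchwinger r.ρ sch (fun s => s.F) k n (fun _ => r.curvature) f : ℝ) : ℂ))
            atTop (𝓝 (S₁ n F))) ∧
      (∃ (F₁ G₁ : 𝓢((Fin 1 → EuclideanSpace ℝ (Fin 4)), ℂ))
        (H₁ : 𝓢((Fin (1 + 1) → EuclideanSpace ℝ (Fin 4)), ℂ)),
        IsTimeOrdered F₁ ∧ IsTimeOrdered G₁ ∧ IsAppendTensorOf H₁ (osAdjoint F₁) G₁ ∧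
          S₁ (1 + 1) H₁ ≠ S₁ 1 (osAdjoint F₁) * S₁ 1 G₁) ∧
      S₁.toLabelled.HasMassGap Δ)
    (h₃ : ∀ {G : Type} [Group G] [TopologicalSpace G] [IsTopologicalGroup G] [CompactSpace G]
    [MeasurableSpace G] [BorelSpace G]
    (hG : IsCompactSimpleLieGroup G) (r : LatticeRep G)
    (βs : ℝ) (ms : ℝ → ℝ) (Ss : ℝ → ℕ) (hpos : ∀ β : ℝ, βs ≤ β → 0 < ms β)
    (hdec : ∀ A B : YMSpecies G, ∃ C : ℝ, ∀ β : ℝ, βs ≤ β → ∀ S n : ℕ, Ss β ≤ S → n ≤ S →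
        |latticeConnectedCorr r.ρ β (2 * S + 1) A.F B.F n| ≤ C * Real.exp (-(ms β * n)))
    (Δ : ℝ) (hΔ : 0 < Δ) (sch : SpeciesScheme (YMSpecies G))
    (hride : Tendsto sch.β atTop atTop ∧ (∀ᶠ k in atTop, βs ≤ sch.β k) ∧
      (∀ k, sch.a k = ms (sch.β k) / Δ) ∧ (∀ᶠ k in atTop, Ss (sch.β k) ≤ sch.L k))
    (S₁ : SchwingerFamily (EuclideanSpace ℝ (Fin 4))) (hOS : OSAxiomsSchwinger S₁.toLabelled)
    (hconv : ∀ (n : ℕ), n ≠ 0 → ∀ (f : Fin n → 𝓢(EuclideanSpace ℝ (Fin 4), ℝ))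
        (F : 𝓢((Fin n → EuclideanSpace ℝ (Fin 4)), ℂ)),
        IsTensorOf F (fun i => ofRealTest (f i)) → IsOffDiagonal F →
          Tendsto (fun k : ℕ =>
            ((latticeSchwinger r.ρ sch (fun s => s.F) k n (fun _ => r.curvature) f : ℝ) : ℂ))
            atTop (𝓝 (S₁ n F)))
    (hnt : ∃ (F₁ G₁ : 𝓢((Fin 1 → EuclideanSpace ℝ (Fin 4)), ℂ))
        (H₁ : 𝓢((Fin (1 + 1) → EuclideanSpace ℝ (Fin 4)), ℂ)),
        IsTimeOrdered F₁ ∧ IsTimeOrdered G₁ ∧ IsAppendTensorOf H₁ (osAdjoint F₁) G₁ ∧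
          S₁ (1 + 1) H₁ ≠ S₁ 1 (osAdjoint F₁) * S₁ 1 G₁)
    (hgap : S₁.toLabelled.HasMassGap Δ),
    ∃ (f g h : 𝓢(EuclideanSpace ℝ (Fin 4), ℂ)) (Ffgh : 𝓢((Fin 3 → EuclideanSpace ℝ (Fin 4)), ℂ))
        (Fgh Ffh Ffg : 𝓢((Fin 2 → EuclideanSpace ℝ (Fin 4)), ℂ))
        (Ff Fg Fh : 𝓢((Fin 1 → EuclideanSpace ℝ (Fin 4)), ℂ)),
        IsTensorOf Ffgh ![f, g, h] ∧ IsOffDiagonal Ffgh ∧ IsTensorOf Fgh ![g, h] ∧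
        IsTensorOf Ffh ![f, h] ∧ IsTensorOf Ffg ![f, g] ∧ IsTensorOf Ff ![f] ∧ IsTensorOf Fg ![g] ∧
        IsTensorOf Fh ![h] ∧
          S₁ 3 Ffgh - S₁ 1 Ff * S₁ 2 Fgh - S₁ 1 Fg * S₁ 2 Ffh - S₁ 1 Fh * S₁ 2 Ffg +
            2 * (S₁ 1 Ff * S₁ 1 Fg * S₁ 1 Fh) ≠ 0) :
    Summit.QuantumFields.YangMills.Theses.DirichletWindow.WeakCouplingContinuumLimit := by
  intro G _ _ _ _ hG H1 H2
  letI : MeasurableSpace G := borel G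
  haveI : BorelSpace G := ⟨rfl⟩
  -- a faithful representation (`IsCompactSimpleLieGroup` = simple ∧ linear)
  obtain ⟨r⟩ := hG.2
  -- H1 for `r`: one uniformly admissible rate
  obtain ⟨β₁, m, S₀, hpos, hdec⟩ := H1 r
  -- STUB 1 (lattice infrared): a uniformly admissible rate saturated by the plaquette
  obtain ⟨βs, ms, Ss, hpos', hdec', hP⟩ := h₁ hG r β₁ m S₀ hpos hdec (H2 r)
  -- H2: the saturated rate is admissible, hence critical
  have hcrit : ∀ m₀ : ℝ, 0 < m₀ → ∀ᶠ β : ℝ in atTop, ms β < m₀ := by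
    refine H2 r βs ms fun β hβ => ⟨hpos' β hβ, Ss β, fun A B => ?_⟩
    obtain ⟨C, hC⟩ := hdec' A B
    exact ⟨C, fun S n hS hn => hC β hβ S n hS hn⟩
  -- STUB 2 (continuum ultraviolet / OS leg): scheme riding `ms` at gap `Δ`, one OS field, alive, massive
  obtain ⟨Δ, sch, S₁, hΔ, hβtop, hβk, hak, hLk, hOS, hconv, hnt, hgap⟩ :=
    h₂ r βs ms Ss hpos' hdec' hcrit hP
  -- STUB 3 (interaction): that limit is not a generalised free field
  have hng := h₃ hG r βs ms Ss hpos' hdec' Δ hΔ sch ⟨hβtop, hβk, hak, hLk⟩ S₁ hOS hconv hnt hgap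
  -- LANDED glue (line `Sketch` of the predecessor crux 8762): all-species packaging by silencing,
  -- and the lattice clause re-indexed along the riding scheme
  obtain ⟨T, hYM, hT1, hT2, hT3⟩ :=
    Theorems.CriticalContinuumLimit.stub_oneFieldExtension r sch S₁ Δ hOS hconv hnt hng hgap
  have hlat : HasLatticeMassGap r (onlySpecies sch r.curvature) Δ :=
    Theorems.CriticalContinuumLimit.stub_latticeGap r βs ms Ss Δ hΔ hdec'
      (onlySpecies sch r.curvature) hβk hak hLk
  -- the new conjunct of the re-typed statement: `β_k → ∞` (silencing keeps `β`)
  have hw : (onlySpecies sch r.curvature).HasWeakCouplingLimit := hβtop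
  exact ⟨r, onlySpecies sch r.curvature, T, hw, hYM, hT1, hT2, Δ, hΔ, hT3, hlat⟩

/-- Signature match: the composition inhabits the crux decl (kernel-checked, modulo the stubs). -/
example : Summit.QuantumFields.YangMills.Theses.DirichletWindow.WeakCouplingContinuumLimit :=
  WeakCouplingContinuumLimit_of

end Summit.QuantumFields.YangMills.Cruxes.WeakCouplingContinuumLimit.Birth

end
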